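import Literature.MathematicalPhysics.QuantumFieldTheory.BalabanImbrieJaffe1984to88.BIJ88LocDeriv230FlatTorus
import Literature.MathematicalPhysics.QuantumFieldTheory.BalabanImbrieJaffe1984to88.BIJ88HkLocHolderTorus

/-!
# `BalabanImbrieJaffe1984to88.BIJ88LocDeriv230ZetaPiFlatTorus` — T. Bałaban, J. Imbrie, A. Jaffe, *Effective action and cluster properties
of the abelian Higgs model*, Commun. Math. Phys. **114** (1988) 257–315 [BalabanImbrieJaffe1988], Sect. 2 p. 263 [PDF 7], (2.28)–(2.30) and
the sentence after (2.33): **THE SMOOTH PRODUCT-FORM CUT-OFF `ζ″ = ζ^Π(R₁, R₀)` OF (2.29) ON THE TORUS OF RECORD AND THE COVARIANT-DERIVATIVE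
MEMBER OF (2.30) FOR IT** — print's *"ζ_k(x₁,x₂) is a smooth function of x₁ − x₂"* realised by r18's `BIJ88HkLocHolderTorus.zetaPi R₁ R₀ 0`
(the SAME 0/1 regions in the sup torus distance as p13's `cutoff R₁ R₀ |·|_T` of gen 26's data, but smooth IN THE LATTICE POINT: first differences
`≤ C_σ/(R₀ − R₁)`, second differences `≤ A₂(C_σ, R₁, R₀)`), and gen 27's derivative member `deriv230_flat_cwt` re-proved with the cut-off as a
PARAMETER (any `|ζ″| ≤ 1` vanishing beyond `R₀` and Lipschitz in the output point), then instantiated on `ζ^Π`.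

statement-level skeleton of published theorems with citation tags; proofs where landed; nothing here is a claim about the Yang–Mills mass gap

PDF held: `paper:balaban1988-cmp114-bij-abelian-higgs-effective-action` (journal page = PDF page + 256); p. 263 [PDF 7] re-read this session
(text layer).

CITATION HEADER (lean-in-tree rule).  Part of the lit-balaban TYPED SKELETON (HOME `run/shared/lean/pub/lit-balaban/`), PHASE-2 proof seat
p29 gen 28 (unit `lit-balaban-p29-g28`; TAKING line HOME/STATUS.md 2026-08-22T22:01:27Z, file (3) of that line — first half; free-target
protocol G.5-34(d)).  Rows **C2.Eq2.29** (the cut-off; owner r18; object of record p13's `BIJ88Cutoffs21.cutoff`, unchanged) and **C2.Claim@263**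
(*"Bounds analogous to (2.30), (2.31) hold for covariant derivatives and Hölder derivatives of G_{k,loc}(u) of order less than two"*; head =
p08's hence-step, unchanged).  WHY A SECOND CUT-OFF: the order `1 + θ` Hölder member of `G_{k,loc}` (the companion `BIJ88LocDerivHolder230FlatTorus`)
differentiates the row weights `x ↦ ζ″(x,y)λ_α(x,y)` TWICE in the output point; p13's `σ((R₀ − |x − y|_T)/(R₀ − R₁))` composes a smooth profile
with the SUP-norm torus distance and is only Lipschitz in `x` (the corner defect recorded in the owner's `C2S14-CLOSURE.md` §3 item 5 for the
(2.4) cut-off — the same phenomenon), whereas print's `ζ_k` is smooth: r18's product form `Π_μ σ((R₀ − |x_μ − y_μ|_T)/(R₀ − R₁))` is, and has the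
same 0/1 regions, so every row fact of gen 26 (`rowHyp_i/ii`, the multiplicity `card_activeLabels_le`) applies to it unchanged.  Kind: theorems
only (no definition, no `Prop`-valued fact; r18's / p31's / p13's / gen 26–27's declarations used BY NAME).

THE PRINTED TEXT (verbatim, p. 263; v1.1: the display (2.29) re-read on the page render `lit-balaban-p31/renders/original-p007-x2.png` and
quoted as printed — v1.0 had put [6]'s profile radii `1/3`, `2/3` of p. 575 here, the owner's second-read note D-r18-g23-1).  *"We then put
G_{k,loc}(u; x₁, x₂) = ζ″_k(x₁, x₂)G̃_k(u; x₁, x₂), (2.28) where ζ″_k(x₁, x₂) is a smooth function of x₁ − x₂, ζ″_k(x₁, x₂) = 0, if |x₁ − x₂| ≧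
(1/(4L)) r(e_{k−1}); 1, if |x₁ − x₂| ≦ (1/(8L)) r(e_{k−1}). (2.29) … |(G_{k,loc}(u)f)(x)| ≦ ce^{−c dist(suppt f,x)}‖f‖_∞, (2.30) … Bounds analogous
to (2.30), (2.31) hold for covariant derivatives and Hölder derivatives of G_{k,loc}(u) of order less than two."*  (The statements below carry the
two radii as free parameters `R₁ < R₀` — here `ζ″ = 1` within `R₁` and `ζ″ = 0` beyond `R₀` in the sup torus distance — so the printed assignment
`R₁ = (1/(8L))r(e_{k−1})·L^k`, `R₀ = (1/(4L))r(e_{k−1})·L^k` fine bonds is one admissible choice; no declaration is affected by this correction.)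

WHAT IS PROVED (theorems only; 0 `sorry`; standard axioms).
* §1 `zetaPi_zero_eq_zero_of_le` / `zetaPi_zero_eq_one_of_le` (the 0/1 regions of `ζ^Π(R₁,R₀)` at scale 0 in the sup torus distance `|·|_T` of
  record), `abs_zetaPi_zero_le_one`, `abs_zetaPi_zero_shift_sub_le` (`|ζ^Π(x + e_ν, y) − ζ^Π(x, y)| ≤ C_σ/(R₀ − R₁)`),
  `abs_zetaPi_zero_secondDiff_le` (`≤ A₂/1` under `1 ≤ R₁`, `R₀ ≤ (|T^{(0)}| − 3)/2`) — r18's lemmas read at `j = 0` (`ctr 0 y = y`, `L⁰ = 1`).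
* §2 `abs_weight_shift_sub_le`, `norm_rowSource_sub_le_of_lipschitz` (one output step of the row weights / row sources for ANY Lipschitz
  cut-off), **`deriv230_flat_of_lipschitz`**
  — for every `K ≥ 0` THERE EXIST `δ₀, c₀ > 0` from `(d, ℓ, a, K)` such that for every volume, `1 ≤ k ≤ K`, no-wrap box `Ω₀` with torus gap
  `≥ R`, `s ≥ 1`, `W ≥ 2s/3 + R₀/2 + R`, `1 < R`, `0 ≤ R₁ < R₀`, every cut-off `ζ″` with `|ζ″| ≤ 1`, `ζ″ = 0` beyond `R₀`, one-step modulus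
  `K/(R₀ − R₁)`, every pure gauge `h`, every deep bond and every `f` (`‖f‖_∞ ≤ F`, support at distance `≥ D` from `x`):
  `‖D^ε_{1^h}(G_{k,loc}(1^h)f)(⟨x, x+e_μ⟩)‖ ≤ (L^kε)·c₀·m·(1 + L^k((R₀ − R₁)⁻¹ + s⁻¹))·e^{−δ₀D/L^k}·F` (gen 27's mechanism verbatim).
* §3 **`deriv230_flat_zetaPi`** — the same for `G_{k,loc}` built from gen 26's torus cubes and weights and the smooth cut-off `ζ″ = ζ^Π(R₁,R₀)`,
  constants from `(d, ℓ, a)` and the tree's universal bound `C_σ` on `|σ′|`, `|σ″|` (`exists_abs_deriv_and_deriv_deriv_smoothTransition_le`).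
HONEST SCOPE.  (i) FLAT / PURE-GAUGE BACKGROUNDS ONLY.  (ii) The cut-off `ζ^Π` is a second admissible instance of the printed (2.29) (same printed
properties plus smoothness in the lattice point); gen 26/27's members for p13's cut-off are NOT modified and nothing is claimed about their
Hölder quotients of order `1 + θ`.  (iii) Hypotheses as gen 27 (both endpoints of the bond at chart depth `≥ R₀` in the no-wrap box, `R > 1`, the
gap); constants explicit, not optimized, `C_σ` non-explicit (compactness).  Imports: gen 27 `BIJ88LocDeriv230FlatTorus` (→ gen 26, p31, p13),
r18 `BIJ88HkLocHolderTorus` (`zetaPi` and its lattice smoothness).  Literature + Mathlib only.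
Unit `lit-balaban-p29` (literature-prover-lit-balaban-p29-g28-0), 2026-08-22; v1.1 = DOCSTRING-ONLY correction of the (2.29) quotation above
(unit `lit-balaban-p29-g29`, literature-prover-lit-balaban-p29-g29-0, 2026-08-23; every declaration byte-identical to v1.0 = p343681).  NOT summit
progress.
-/

open scoped BigOperators Matrix ComplexConjugate
open Finset Matrix Set

namespace Literature.MathematicalPhysics.QuantumFieldTheory.BalabanImbrieJaffe1984to88.BIJ88LocDeriv230ZetaPiFlatTorus

open Literature.MathematicalPhysics.QuantumFieldTheory.Balaban1983to89
open BIJ88Sect3Statements (U1 toC cfg covD)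
open BIJ85BlockAveragesTorus BIJ85BlockAveragesTorusK
open BIJ85Ineq722Torus (ctr distEU)
open BIJ88NeumannPropagator227Torus (gBox)
open BIJ88DeltaLoc234Torus (gLocT)
open BIJ88NeumannPropagatorFlatDecayCube
open BIJ88NeumannPropagatorFlatClose231 (gLocT_mulVec_apply norm_rowSource_le rowSource_ne_zero abs_lam_le_one)
open BIJ88DeltaLocFlatClose235 (decay110_flat_cube_level decay110_flat_cube_deriv_level)
open BIJ88ConvexWeights227 (cwt abs_cwt_sub_le)
open BIJ88LocWeights227Torus
open BIJ88LocDeriv230FlatTorus (T_shift_le_one abs_T_shift_sub_le boxCoord_shift abs_lamT_shift_sub_le covD_gLocT_apply)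
open BIJ88HkLocHolderTorus (zetaPi zetaPi_nonneg zetaPi_le_one abs_zetaPi_le_one abs_zetaPi_shift_sub_le abs_zetaPi_secondDiff_le
  secondDiffConst secondDiffConst_nonneg isCutoff_zetaPiB)
open B4Reflection242 (boxDom mem_boxDom)
open GaugeField (gaugeAct)
open Literature.Analysis.Calculus (exists_abs_deriv_and_deriv_deriv_smoothTransition_le)

noncomputable section

variable {d : ℕ} {P : Params}

/-! ## §1 The product-form cut-off `ζ^Π(R₁, R₀)` at scale `0` on the torus of record -/

section ZetaPiZero

/-- kernel: at scale `0` the block centre is the site itself. [cite: BalabanImbrieJaffe1985, (7.2.2) p.325] -/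
private theorem ctr_zero (y : Balaban1983to89.Site P 0) : ctr 0 y = y := by
  funext m
  simp [ctr]

/-- kernel: at scale `0` r18's distance `distEU` is the sup torus distance `|·|_T` of record (p39's `T_eq_supDist`).
[cite: Balaban1982Higgs1, (1.3) p.604, dictionary] -/
private theorem distEU_zero_eq_T (x y : Balaban1983to89.Site P 0) : distEU P 0 x y = B5Ineq137Torus.T P 0 x y := by
  rw [distEU, ctr_zero, pow_zero, div_one, B3Bound323ZeroTorus.T_eq_supDist]

/-- **`ζ^Π(R₁,R₀)(x, y) = 0` for `|x − y|_T ≥ R₀`** — the support half of (2.29) for the smooth product cut-off at scale 0, in the sup torus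
distance of gen 26's data (the hypothesis `hζ` of gen 26's row facts). [cite: BalabanImbrieJaffe1988, (2.29) p.263] -/
theorem zetaPi_zero_eq_zero_of_le {R₁ R₀ : ℝ} (hR : R₁ < R₀) :
    ∀ x y : Balaban1983to89.Site P 0, R₀ ≤ B5Ineq137Torus.T P 0 x y → zetaPi R₁ R₀ 0 x y = 0 := by
  intro x y h
  have h' : R₀ ≤ distEU P 0 x y := by rw [distEU_zero_eq_T]; exact h
  exact (isCutoff_zetaPiB (P := P) hR 0).2 ⟨x, ⟨0, P.hd⟩⟩ ⟨y, ⟨0, P.hd⟩⟩ h'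

/-- **`ζ^Π(R₁,R₀)(x, y) = 1` for `|x − y|_T ≤ R₁`** — the other half of (2.29). [cite: BalabanImbrieJaffe1988, (2.29) p.263] -/
theorem zetaPi_zero_eq_one_of_le {R₁ R₀ : ℝ} (hR : R₁ < R₀) :
    ∀ x y : Balaban1983to89.Site P 0, B5Ineq137Torus.T P 0 x y ≤ R₁ → zetaPi R₁ R₀ 0 x y = 1 := by
  intro x y h
  have h' : distEU P 0 x y ≤ R₁ := by rw [distEU_zero_eq_T]; exact h
  exact (isCutoff_zetaPiB (P := P) hR 0).1 ⟨x, ⟨0, P.hd⟩⟩ ⟨y, ⟨0, P.hd⟩⟩ h'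

/-- `|ζ^Π| ≤ 1` (the data hypothesis `hζ` of p31's members). [cite: BalabanImbrieJaffe1988, (2.29) p.263] -/
theorem abs_zetaPi_zero_le_one (R₁ R₀ : ℝ) : ∀ x y : Balaban1983to89.Site P 0, |zetaPi R₁ R₀ 0 x y| ≤ 1 :=
  fun x y => abs_zetaPi_le_one R₁ R₀ 0 x y

/-- **ONE LATTICE STEP OF THE OUTPUT POINT CHANGES `ζ^Π(R₁,R₀)` BY AT MOST `C/(R₀ − R₁)`** (`|σ′| ≤ C`; r18's `abs_zetaPi_shift_sub_le` at
`j = 0`). [cite: BalabanImbrieJaffe1988, (2.29) p.263] -/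
theorem abs_zetaPi_zero_shift_sub_le {C : ℝ} (hC : ∀ u, |deriv Real.smoothTransition u| ≤ C) {R₁ R₀ : ℝ} (hR : R₁ < R₀) :
    ∀ (x y : Balaban1983to89.Site P 0) (ν : Fin P.d), |zetaPi R₁ R₀ 0 (x.shift ν) y - zetaPi R₁ R₀ 0 x y| ≤ C / (R₀ - R₁) := by
  intro x y ν
  have h := abs_zetaPi_shift_sub_le (P := P) hC hR 0 x y ν
  rwa [pow_zero, div_one] at h

/-- **THE SECOND DIFFERENCES OF `ζ^Π(R₁,R₀)` IN THE OUTPUT POINT ARE `≤ A₂ = (C/(R₀−R₁))² + C/(R₀−R₁)²`** for all directions `κ, λ`, provided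
`1 ≤ R₁` and `R₀ ≤ (|T^{(0)}| − 3)/2` (r18's `abs_zetaPi_secondDiff_le` at `j = 0`) — the lattice form of print's *"smooth function of
x₁ − x₂"*. [cite: BalabanImbrieJaffe1988, (2.29) p.263] -/
theorem abs_zetaPi_zero_secondDiff_le {C : ℝ} (hC1 : ∀ u, |deriv Real.smoothTransition u| ≤ C)
    (hC2 : ∀ u, |deriv (deriv Real.smoothTransition) u| ≤ C) {R₁ R₀ : ℝ} (hR : R₁ < R₀) (h1 : 1 ≤ R₁)
    (h2 : R₀ ≤ ((P.sitesPerDir 0 : ℝ) - 3) / 2) :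
    ∀ (x y : Balaban1983to89.Site P 0) (κ lam : Fin P.d),
      |zetaPi R₁ R₀ 0 ((x.shift lam).shift κ) y - zetaPi R₁ R₀ 0 (x.shift lam) y - zetaPi R₁ R₀ 0 (x.shift κ) y + zetaPi R₁ R₀ 0 x y| ≤
        secondDiffConst C R₁ R₀ := by
  intro x y κ lam
  have h := abs_zetaPi_secondDiff_le (P := P) hC1 hC2 hR 0 (by rw [pow_zero, mul_one]; exact h1) (by rw [pow_zero, mul_one]; exact h2) x y κ lam
  rwa [pow_zero, one_pow, div_one] at h

end ZetaPiZero

/-! ## §2 The covariant-derivative member of (2.30) for ANY Lipschitz cut-off (gen 27's mechanism, cut-off a parameter) -/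

section Generic

variable (hPd : P.d = d + 1) {n : ℕ} {c M0 : Fin (d + 1) → ℕ} {s : ℕ}

/-- **One lattice step of the output point changes the row weight `w_α(x, y) = ζ″(x, y)λ_α(x, y)` by at most `K_ζ + 3π(d+1)/(2s)`** for
ANY cut-off with `|ζ″| ≤ 1` and one-step modulus `K_ζ` at `x`, and gen 26's weights (`x`, `x + e_μ ∈ Ω₀`; gen 27's `abs_lamT_shift_sub_le`).
[cite: BalabanImbrieJaffe1988, (2.27)–(2.29) p.263] -/
theorem abs_weight_shift_sub_le (hs : 0 < s) (hfit : ∀ i, c i * n + n * M0 i ≤ P.sitesPerDir 0)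
    (hN : ∀ i, n * M0 i < P.sitesPerDir 0) {ζ : Balaban1983to89.Site P 0 → Balaban1983to89.Site P 0 → ℝ} {Kζ : ℝ} (hKζ : 0 ≤ Kζ)
    (hζabs : ∀ x y, |ζ x y| ≤ 1) {x : Balaban1983to89.Site P 0} {μ : Fin P.d} (hζlip : ∀ y, |ζ (x.shift μ) y - ζ x y| ≤ Kζ)
    (α : Fin (d + 1) → ℤ) (hx : x ∈ cubeT hPd n c fun i => n * M0 i) (hxe : x.shift μ ∈ cubeT hPd n c fun i => n * M0 i)
    (y : Balaban1983to89.Site P 0) :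
    |ζ (x.shift μ) y * lamT hPd n c M0 s α (x.shift μ) y - ζ x y * lamT hPd n c M0 s α x y| ≤ Kζ + 3 * Real.pi * (d + 1 : ℕ) / (2 * s) := by
  set ζ' := ζ (x.shift μ) y with hζ'def
  set ζ₀ := ζ x y with hζ₀def
  set l' := lamT hPd n c M0 s α (x.shift μ) y with hl'def
  set l := lamT hPd n c M0 s α x y with hldef
  have hζ1 : |ζ' - ζ₀| ≤ Kζ := hζlip y
  have hl1 : |l' - l| ≤ 3 * Real.pi * (d + 1 : ℕ) / (2 * s) := abs_lamT_shift_sub_le hPd hs hfit hN α hx hxe y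
  have hl'1 : |l'| ≤ 1 := by
    rw [hl'def, abs_of_nonneg (lamT_nonneg _ _ _)]
    by_cases hy : y ∈ cubeT hPd n c fun i => n * M0 i
    · rw [lamT_of_mem α hxe hy]; exact BIJ88ConvexWeights227.cwt_le_one _ _ _ _
    · rw [lamT_of_not α (fun h => hy h.2)]; exact zero_le_one
  have hζ01 : |ζ₀| ≤ 1 := hζabs x y
  have e : ζ' * l' - ζ₀ * l = (ζ' - ζ₀) * l' + ζ₀ * (l' - l) := by ring
  rw [e]
  refine (abs_add_le _ _).trans ?_
  rw [abs_mul, abs_mul]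
  have h1 : |ζ' - ζ₀| * |l'| ≤ Kζ := by
    calc |ζ' - ζ₀| * |l'| ≤ Kζ * 1 := mul_le_mul hζ1 hl'1 (abs_nonneg _) hKζ
      _ = _ := mul_one _
  have h2 : |ζ₀| * |l' - l| ≤ 3 * Real.pi * (d + 1 : ℕ) / (2 * s) := by
    calc |ζ₀| * |l' - l| ≤ 1 * (3 * Real.pi * (d + 1 : ℕ) / (2 * s)) := mul_le_mul hζ01 hl1 (abs_nonneg _) zero_le_one
      _ = _ := one_mul _
  exact add_le_add h1 h2

/-- **The difference of the row sources of two neighbouring output points** for ANY cut-off with `|ζ″| ≤ 1` and one-step modulus `K_ζ` in the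
output point, and gen 26's weights (`x`, `x + e_μ ∈ Ω₀`, `‖f‖_∞ ≤ F`): `‖g_{x+e_μ,α}(y) − g_{x,α}(y)‖ ≤ (K_ζ + 3π(d+1)/(2s))·F` (gen 27's
`norm_rowSource_sub_le` with the cut-off a parameter). [cite: BalabanImbrieJaffe1988, (2.28) p.263] -/
theorem norm_rowSource_sub_le_of_lipschitz (hs : 0 < s) (hfit : ∀ i, c i * n + n * M0 i ≤ P.sitesPerDir 0)
    (hN : ∀ i, n * M0 i < P.sitesPerDir 0) {ζ : Balaban1983to89.Site P 0 → Balaban1983to89.Site P 0 → ℝ} {Kζ : ℝ} (hKζ : 0 ≤ Kζ)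
    (hζabs : ∀ x y, |ζ x y| ≤ 1) {x : Balaban1983to89.Site P 0} {μ : Fin P.d} (hζlip : ∀ y, |ζ (x.shift μ) y - ζ x y| ≤ Kζ)
    (α : Fin (d + 1) → ℤ) (hx : x ∈ cubeT hPd n c fun i => n * M0 i) (hxe : x.shift μ ∈ cubeT hPd n c fun i => n * M0 i)
    {f : Balaban1983to89.Site P 0 → ℂ} {F : ℝ} (hF : ∀ y, ‖f y‖ ≤ F) (y : Balaban1983to89.Site P 0) :
    ‖((ζ (x.shift μ) y : ℂ) * (lamT hPd n c M0 s α (x.shift μ) y : ℂ) - (ζ x y : ℂ) * (lamT hPd n c M0 s α x y : ℂ)) * f y‖ ≤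
      (Kζ + 3 * Real.pi * (d + 1 : ℕ) / (2 * s)) * F := by
  have hF0 : 0 ≤ F := (norm_nonneg _).trans (hF y)
  have hreal := abs_weight_shift_sub_le hPd hs hfit hN hKζ hζabs hζlip α hx hxe y
  have hcast : ((ζ (x.shift μ) y : ℂ) * (lamT hPd n c M0 s α (x.shift μ) y : ℂ) - (ζ x y : ℂ) * (lamT hPd n c M0 s α x y : ℂ)) =
      ((ζ (x.shift μ) y * lamT hPd n c M0 s α (x.shift μ) y - ζ x y * lamT hPd n c M0 s α x y : ℝ) : ℂ) := by push_cast; ring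
  rw [hcast, norm_mul, Complex.norm_real, Real.norm_eq_abs]
  exact mul_le_mul hreal (hF y) (norm_nonneg _) (by positivity)

/-- kernel: the label of a fine site over its own `k`-block site. [cite: BalabanImbrieJaffe1985, (2.4) p.302, dictionary] -/
private theorem mem_blockK_blkIter {k : ℕ} (x : Balaban1983to89.Site P 0) : x ∈ blockK k (blkIter k x) :=
  mem_blockK.2 rfl

/-- **THE COVARIANT-DERIVATIVE MEMBER OF (2.30) AT `u = 1^h` FOR THE TORUS CUBES AND WEIGHTS OF RECORD AND ANY LIPSCHITZ CUT-OFF**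
(gen 27's `deriv230_flat_cwt` with the cut-off of (2.29) made a PARAMETER): for every Lipschitz modulus parameter `K ≥ 0` THERE EXIST
`δ₀, c₀ > 0` depending on `(d, ℓ, a, K)` only such that for every volume, every `1 ≤ k ≤ K`, every no-wrap box `Ω₀` shorter than the torus
leaving a torus gap `≥ R`, cube spacing `s ≥ 1`, half-width `W ≥ 2s/3 + R₀/2 + R`, radii `1 < R`, `0 ≤ R₁ < R₀`, EVERY real cut-off `ζ″` with
`|ζ″| ≤ 1`, `ζ″(x,y) = 0` for `|x − y|_T ≥ R₀` and `|ζ″(x + e_ν, y) − ζ″(x, y)| ≤ K/(R₀ − R₁)`, every pure gauge `h`, every bond `⟨x, x+e_μ⟩`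
with both endpoints in `Ω₀` at chart depth `≥ R₀`, and every `f` with `‖f‖_∞ ≤ F` supported at sup-torus distance `≥ D ≥ 0` from `x`:
`‖ε⁻¹(u(b)(G_{k,loc}(1^h)f)(x + e_μ) − (G_{k,loc}(1^h)f)(x))‖ ≤ (L^kε)·c₀·m·(1 + L^k·((R₀ − R₁)⁻¹ + s⁻¹))·e^{−δ₀D/L^k}·F`,
`m = (⌊(L^k − 1 + R₀)/s⌋ + 3)^{d+1}` — the mechanism of gen 27 verbatim (bond identity, [6]'s derivative member on the active cubes, value
member on the Lipschitz difference sources). [cite: BalabanImbrieJaffe1988, (2.30) p.263] -/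
theorem deriv230_flat_of_lipschitz (d ℓ : ℕ) (hℓ : 1 ≤ ℓ) {a : ℝ} (ha : 0 < a) {K : ℝ} (hK0 : 0 ≤ K) :
    ∃ δ₀ c₀ : ℝ, 0 < δ₀ ∧ 0 < c₀ ∧ ∀ (P : Params) (hPd : P.d = d + 1), P.L = ℓ + 1 →
      ∀ k : ℕ, 1 ≤ k → k ≤ P.K → ∀ (c M0 : Fin (d + 1) → ℕ), (∀ i, 1 ≤ M0 i) →
        (∀ i, c i * P.L ^ k + P.L ^ k * M0 i ≤ P.sitesPerDir 0) → (∀ i, P.L ^ k * M0 i < P.sitesPerDir 0) →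
      ∀ (s W : ℕ), 1 ≤ s → ∀ (R R₀ R₁ : ℝ), 1 < R → 0 ≤ R₁ → R₁ < R₀ → 2 * (s : ℝ) / 3 + R₀ / 2 + R ≤ W →
        (∀ i, ((P.L ^ k * M0 i : ℕ) : ℝ) + R ≤ P.sitesPerDir 0) →
      ∀ (ζ : Balaban1983to89.Site P 0 → Balaban1983to89.Site P 0 → ℝ), (∀ x y, |ζ x y| ≤ 1) →
        (∀ x y, R₀ ≤ B5Ineq137Torus.T P 0 x y → ζ x y = 0) →
        (∀ (x y : Balaban1983to89.Site P 0) (ν : Fin P.d), |ζ (x.shift ν) y - ζ x y| ≤ K / (R₀ - R₁)) →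
      ∀ (h : GaugeTransf P 0 U1) (x : Balaban1983to89.Site P 0) (μ : Fin P.d),
        x ∈ (cubeT hPd (P.L ^ k) c fun i => P.L ^ k * M0 i) →
        (∀ i, R₀ ≤ (boxCoord hPd (P.L ^ k) c x i : ℝ) ∧ (boxCoord hPd (P.L ^ k) c x i : ℝ) + R₀ ≤ (P.L ^ k * M0 i : ℕ) - 1) →
        x.shift μ ∈ (cubeT hPd (P.L ^ k) c fun i => P.L ^ k * M0 i) →
        (∀ i, R₀ ≤ (boxCoord hPd (P.L ^ k) c (x.shift μ) i : ℝ) ∧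
          (boxCoord hPd (P.L ^ k) c (x.shift μ) i : ℝ) + R₀ ≤ (P.L ^ k * M0 i : ℕ) - 1) →
      ∀ (f : Balaban1983to89.Site P 0 → ℂ) (F D : ℝ), (∀ y, ‖f y‖ ≤ F) → 0 ≤ D → (∀ y, f y ≠ 0 → D ≤ B5Ineq137Torus.T P 0 x y) →
        ‖covD P.eps⁻¹ (cfg (gaugeAct h (1 : GaugeField P 0 U1)))
            (gLocT (B1RG242Torus.α P a k * (P.L : ℝ) ^ (k * P.d)) P.eps⁻¹ (gaugeAct h (1 : GaugeField P 0 U1)) k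
              (cubeFam hPd (P.L ^ k) c M0 s W) (lamFam hPd (P.L ^ k) c M0 s) ζ *ᵥ f) ⟨x, μ⟩‖ ≤
          P.spacing k * (c₀ * (⌊(((P.L : ℝ) ^ k) - 1 + R₀) / s⌋₊ + 3) ^ (d + 1) *
            (1 + (P.L : ℝ) ^ k * ((R₀ - R₁)⁻¹ + (s : ℝ)⁻¹)) * Real.exp (-(δ₀ * (((P.L : ℝ) ^ k)⁻¹ * D))) * F) := by
  obtain ⟨δ₁, c₁, hδ₁, hc₁, H1⟩ := decay110_flat_cube_deriv_level d ℓ hℓ ha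
  obtain ⟨δ₂, c₂, hδ₂, hc₂, H2⟩ := decay110_flat_cube_level d ℓ hℓ ha
  -- the constants: rate `min δ₁ δ₂`, prefactor `max c₁ (2c₂·max(K, 3π(d+1)/2))`
  set Λ₀ : ℝ := max K (3 * Real.pi * (d + 1 : ℕ) / 2) with hΛ₀def
  have hΛ₀0 : 0 ≤ Λ₀ := hK0.trans (le_max_left _ _)
  refine ⟨min δ₁ δ₂, max c₁ (2 * c₂ * Λ₀ + 1), lt_min hδ₁ hδ₂, lt_max_of_lt_left hc₁, ?_⟩
  intro P hPd hPL k hk1 hkK c M0 hM0 hfit0 hN0 s W hs R R₀ R₁ hR hR₁ hR10 hW hgap ζ hζabs hζ0 hζlip h x μ hx hdeep hxe hdeepe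
    f F D hF hD hsupp
  set δ := min δ₁ δ₂ with hδdef
  set C := max c₁ (2 * c₂ * Λ₀ + 1) with hCdef
  have hδ1 : δ ≤ δ₁ := min_le_left _ _
  have hδ2 : δ ≤ δ₂ := min_le_right _ _
  have hC1 : c₁ ≤ C := le_max_left _ _
  have hC2 : 2 * c₂ * Λ₀ + 1 ≤ C := le_max_right _ _
  have hC0 : 0 ≤ C := hc₁.le.trans hC1
  have hn : 1 ≤ P.L ^ k := Nat.one_le_pow _ _ P.L_pos
  have hk : 0 + k ≤ P.m + P.K := by omega
  have hR0 : 0 ≤ R := zero_le_one.trans hR.le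
  have hR₀ : 0 ≤ R₀ := hR₁.trans hR10.le
  have hs0 : 0 < s := hs
  have hsr : (0 : ℝ) < s := by exact_mod_cast hs0
  have hgap' : 0 < R₀ - R₁ := sub_pos.2 hR10
  have hLpos : (0 : ℝ) < P.L := P.cast_L_pos
  have hLk : (0 : ℝ) < (P.L : ℝ) ^ k := pow_pos hLpos _
  have hε : 0 < ((P.L : ℝ) ^ k)⁻¹ := inv_pos.mpr hLk
  have hF0 : 0 ≤ F := (norm_nonneg _).trans (hF x)
  have hsp0 : 0 < P.spacing k := P.spacing_pos k
  have heps : 0 < P.eps := P.eps_pos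
  -- abbreviations
  set Ω₀ : Finset (Balaban1983to89.Site P 0) := cubeT hPd (P.L ^ k) c fun i => P.L ^ k * M0 i with hΩ₀def
  set A : ℝ := B1RG242Torus.α P a k * (P.L : ℝ) ^ (k * P.d) with hAdef
  set U : GaugeField P 0 U1 := gaugeAct h (1 : GaugeField P 0 U1) with hUdef
  set x' := x.shift μ with hx'def
  set m : ℝ := ((⌊(((P.L : ℝ) ^ k) - 1 + R₀) / s⌋₊ : ℝ) + 3) ^ (d + 1) with hmdef
  have hm0 : 0 ≤ m := by rw [hmdef]; positivity
  set E : ℝ := Real.exp (-(δ * (((P.L : ℝ) ^ k)⁻¹ * D))) with hEdef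
  have hE0 : 0 < E := Real.exp_pos _
  have hεD : 0 ≤ ((P.L : ℝ) ^ k)⁻¹ * D := mul_nonneg hε.le hD
  have hE1 : Real.exp (-(δ₁ * (((P.L : ℝ) ^ k)⁻¹ * D))) ≤ E := Real.exp_le_exp.2 (by nlinarith)
  have hE2 : Real.exp (-(δ₂ * (((P.L : ℝ) ^ k)⁻¹ * D))) ≤ E := Real.exp_le_exp.2 (by nlinarith)
  -- the sources
  set g' : ↥(labels (P.L ^ k) M0 s) → Balaban1983to89.Site P 0 → ℂ :=
    fun α y => (ζ x' y : ℂ) * (lamFam hPd (P.L ^ k) c M0 s α x' y : ℂ) * f y with hg'def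
  set dg : ↥(labels (P.L ^ k) M0 s) → Balaban1983to89.Site P 0 → ℂ :=
    fun α y => ((ζ x' y : ℂ) * (lamFam hPd (P.L ^ k) c M0 s α x' y : ℂ) - (ζ x y : ℂ) * (lamFam hPd (P.L ^ k) c M0 s α x y : ℂ)) * f y
    with hdgdef
  -- the identity (sources folded)
  have hid : covD P.eps⁻¹ (cfg U) (gLocT A P.eps⁻¹ U k (cubeFam hPd (P.L ^ k) c M0 s W) (lamFam hPd (P.L ^ k) c M0 s) ζ *ᵥ f) ⟨x, μ⟩ =
      ∑ α, covD P.eps⁻¹ (cfg U) (gBox A P.eps⁻¹ U k (cubeFam hPd (P.L ^ k) c M0 s W α) *ᵥ g' α) ⟨x, μ⟩ +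
      ∑ α, ((P.eps⁻¹ : ℝ) : ℂ) * (gBox A P.eps⁻¹ U k (cubeFam hPd (P.L ^ k) c M0 s W α) *ᵥ dg α) x :=
    covD_gLocT_apply P.eps⁻¹ (cfg U) A P.eps⁻¹ U k (cubeFam hPd (P.L ^ k) c M0 s W) (lamFam hPd (P.L ^ k) c M0 s) ζ f ⟨x, μ⟩
  rw [hid]
  -- the active-label sets of the two endpoints
  set Sx : Finset ↥(labels (P.L ^ k) M0 s) := (activeLabels hPd (P.L ^ k) c s R₀ (blkIter k x)).subtype fun α => α ∈ labels (P.L ^ k) M0 s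
    with hSxdef
  set Sx' : Finset ↥(labels (P.L ^ k) M0 s) := (activeLabels hPd (P.L ^ k) c s R₀ (blkIter k x')).subtype fun α => α ∈ labels (P.L ^ k) M0 s
    with hSx'def
  have hcardx : (Sx.card : ℝ) ≤ m := by
    have h1 := card_subtype_activeLabels_le (hPd := hPd) (c := c) (M0 := M0) hn hs0 hR₀ (blkIter k x)
    have e : (((P.L ^ k : ℕ) : ℕ) : ℝ) = (P.L : ℝ) ^ k := by push_cast; rfl
    rw [hSxdef, hmdef]; rw [e] at h1; exact h1
  have hcardx' : (Sx'.card : ℝ) ≤ m := by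
    have h1 := card_subtype_activeLabels_le (hPd := hPd) (c := c) (M0 := M0) hn hs0 hR₀ (blkIter k x')
    have e : (((P.L ^ k : ℕ) : ℕ) : ℝ) = (P.L : ℝ) ^ k := by push_cast; rfl
    rw [hSx'def, hmdef]; rw [e] at h1; exact h1
  have hSx : ∀ (α : ↥(labels (P.L ^ k) M0 s)) (y : Balaban1983to89.Site P 0),
      ζ x y * lamFam hPd (P.L ^ k) c M0 s α x y ≠ 0 → α ∈ Sx := by
    intro α y hne
    rw [hSxdef, Finset.mem_subtype]
    exact mem_activeLabels_of_ne_zero_of_deep hk hs0 hfit0 hζ0 (mem_blockK_blkIter x) hdeep hne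
  have hSx' : ∀ (α : ↥(labels (P.L ^ k) M0 s)) (y : Balaban1983to89.Site P 0),
      ζ x' y * lamFam hPd (P.L ^ k) c M0 s α x' y ≠ 0 → α ∈ Sx' := by
    intro α y hne
    rw [hSx'def, Finset.mem_subtype]
    exact mem_activeLabels_of_ne_zero_of_deep hk hs0 hfit0 hζ0 (mem_blockK_blkIter x') hdeepe hne
  -- TERM 1: [6]'s derivative member for the cubes active at `x'`
  set B₁ : ℝ := P.spacing k * (c₁ * Real.exp (-(δ₁ * (((P.L : ℝ) ^ k)⁻¹ * D))) * F) with hB₁def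
  have hB₁0 : 0 ≤ B₁ := by positivity
  have hterm1 : ∀ α, ‖covD P.eps⁻¹ (cfg U) (gBox A P.eps⁻¹ U k (cubeFam hPd (P.L ^ k) c M0 s W α) *ᵥ g' α) ⟨x, μ⟩‖ ≤ B₁ := by
    intro α
    by_cases hex : ∃ y, ζ x' y * lamFam hPd (P.L ^ k) c M0 s α x' y ≠ 0
    · obtain ⟨y₀, hy₀⟩ := hex
      -- both endpoints lie in the active cube
      obtain ⟨hx'α, -, hfar⟩ := rowHyp_ii hPd hn hs0 hfit0 hR0 hgap hW hζ0 hxe hdeepe α y₀ hy₀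
      have hxα : x ∈ cubeFam hPd (P.L ^ k) c M0 s W α := by
        by_contra hnot
        have h1 := (hfar x hx hnot).1
        have h2 : B5Ineq137Torus.T P 0 x' x ≤ 1 := by
          rw [B5Ineq137Torus.T_symm]; exact T_shift_le_one x μ
        linarith
      obtain ⟨c', M', hM', hfit', hN', hcα⟩ := cubeFam_fits (hPd := hPd) (s := s) (W := W) hM0 hfit0 hN0 α
      have hcα' : cubeOf hPd (P.L ^ k) c M0 s W α.1 = cubeT hPd (P.L ^ k) c' fun i => P.L ^ k * M' i := hcα
      rw [hcα'] at hx'α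
      rw [hcα] at hxα ⊢
      refine (H1 P hPd hPL k hk1 hkK c' M' hM' hfit' hN' h x (g' α) F D
        (fun y => norm_rowSource_le (hζabs x' y) (abs_lam_le_one (sum_abs_lamT_le_one hfit0) α x' y) hF y)
        (fun y hy => hsupp y (rowSource_ne_zero hy).2) μ hxα hx'α).trans ?_
      exact le_rfl
    · push Not at hex
      have h0 : g' α = 0 := by
        funext y; rw [hg'def]; dsimp only; rw [← Complex.ofReal_mul, hex y, Complex.ofReal_zero, zero_mul]; rfl
      rw [h0, mulVec_zero]
      simp only [covD, Pi.zero_apply, mul_zero, sub_zero, norm_zero]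
      exact hB₁0
  have hzero1 : ∀ α, α ∉ Sx' → covD P.eps⁻¹ (cfg U) (gBox A P.eps⁻¹ U k (cubeFam hPd (P.L ^ k) c M0 s W α) *ᵥ g' α) ⟨x, μ⟩ = 0 := by
    intro α hα
    have h0 : g' α = 0 := by
      funext y
      by_contra hne
      exact hα (hSx' α y (rowSource_ne_zero hne).1)
    rw [h0, mulVec_zero]
    simp only [covD, Pi.zero_apply, mul_zero, sub_zero]
  have hsum1 : ‖∑ α, covD P.eps⁻¹ (cfg U) (gBox A P.eps⁻¹ U k (cubeFam hPd (P.L ^ k) c M0 s W α) *ᵥ g' α) ⟨x, μ⟩‖ ≤ m * B₁ := by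
    rw [← Finset.sum_subset (Finset.subset_univ Sx') (fun α _ hα => hzero1 α hα)]
    calc ‖∑ α ∈ Sx', covD P.eps⁻¹ (cfg U) (gBox A P.eps⁻¹ U k (cubeFam hPd (P.L ^ k) c M0 s W α) *ᵥ g' α) ⟨x, μ⟩‖
        ≤ ∑ α ∈ Sx', ‖covD P.eps⁻¹ (cfg U) (gBox A P.eps⁻¹ U k (cubeFam hPd (P.L ^ k) c M0 s W α) *ᵥ g' α) ⟨x, μ⟩‖ := norm_sum_le _ _
      _ ≤ ∑ α ∈ Sx', B₁ := Finset.sum_le_sum fun α _ => hterm1 α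
      _ = Sx'.card * B₁ := by rw [Finset.sum_const, nsmul_eq_mul]
      _ ≤ m * B₁ := mul_le_mul_of_nonneg_right hcardx' hB₁0
  -- TERM 2: [6]'s value member on the difference sources, for the cubes active at `x` or `x'`
  set Λ : ℝ := K / (R₀ - R₁) + 3 * Real.pi * (d + 1 : ℕ) / (2 * s) with hΛdef
  have hΛ0 : 0 ≤ Λ := by rw [hΛdef]; positivity
  set B₂ : ℝ := P.spacing k ^ 2 * (c₂ * Real.exp (-(δ₂ * (((P.L : ℝ) ^ k)⁻¹ * D))) * (Λ * F)) with hB₂def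
  have hB₂0 : 0 ≤ B₂ := by positivity
  have hterm2 : ∀ α, ‖(gBox A P.eps⁻¹ U k (cubeFam hPd (P.L ^ k) c M0 s W α) *ᵥ dg α) x‖ ≤ B₂ := by
    intro α
    obtain ⟨c', M', hM', hfit', hN', hcα⟩ := cubeFam_fits (hPd := hPd) (s := s) (W := W) hM0 hfit0 hN0 α
    rw [hcα]
    exact H2 P hPd hPL k hk1 hkK c' M' hM' hfit' hN' h x (dg α) (Λ * F) D
      (fun y => norm_rowSource_sub_le_of_lipschitz hPd hs0 hfit0 hN0 (div_nonneg hK0 hgap'.le) hζabs (fun y => hζlip x y μ) α.1 hx hxe hF y)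
      (fun y hy => hsupp y (right_ne_zero_of_mul hy))
  have hzero2 : ∀ α, α ∉ Sx ∪ Sx' → (gBox A P.eps⁻¹ U k (cubeFam hPd (P.L ^ k) c M0 s W α) *ᵥ dg α) x = 0 := by
    intro α hα
    rw [Finset.mem_union, not_or] at hα
    have h0 : dg α = 0 := by
      funext y
      rw [hdgdef]; dsimp only
      have h1 : ζ x' y * lamFam hPd (P.L ^ k) c M0 s α x' y = 0 := by
        by_contra hne; exact hα.2 (hSx' α y hne)
      have h2 : ζ x y * lamFam hPd (P.L ^ k) c M0 s α x y = 0 := by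
        by_contra hne; exact hα.1 (hSx α y hne)
      rw [← Complex.ofReal_mul, ← Complex.ofReal_mul, h1, h2]; simp
    rw [h0, mulVec_zero, Pi.zero_apply]
  have hcardU : ((Sx ∪ Sx').card : ℝ) ≤ 2 * m := by
    have h1 : ((Sx ∪ Sx').card : ℝ) ≤ (Sx.card : ℝ) + (Sx'.card : ℝ) := by exact_mod_cast Finset.card_union_le _ _
    linarith
  have hsum2 : ‖∑ α, ((P.eps⁻¹ : ℝ) : ℂ) * (gBox A P.eps⁻¹ U k (cubeFam hPd (P.L ^ k) c M0 s W α) *ᵥ dg α) x‖ ≤ P.eps⁻¹ * (2 * m * B₂) := by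
    rw [← Finset.mul_sum, norm_mul, Complex.norm_real, Real.norm_eq_abs, abs_of_pos (inv_pos.mpr heps)]
    refine mul_le_mul_of_nonneg_left ?_ (inv_pos.mpr heps).le
    rw [← Finset.sum_subset (Finset.subset_univ (Sx ∪ Sx')) (fun α _ hα => hzero2 α hα)]
    calc ‖∑ α ∈ Sx ∪ Sx', (gBox A P.eps⁻¹ U k (cubeFam hPd (P.L ^ k) c M0 s W α) *ᵥ dg α) x‖
        ≤ ∑ α ∈ Sx ∪ Sx', ‖(gBox A P.eps⁻¹ U k (cubeFam hPd (P.L ^ k) c M0 s W α) *ᵥ dg α) x‖ := norm_sum_le _ _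
      _ ≤ ∑ α ∈ Sx ∪ Sx', B₂ := Finset.sum_le_sum fun α _ => hterm2 α
      _ = (Sx ∪ Sx').card * B₂ := by rw [Finset.sum_const, nsmul_eq_mul]
      _ ≤ 2 * m * B₂ := mul_le_mul_of_nonneg_right hcardU hB₂0
  -- assembling: `m·B₁ + ε⁻¹·2m·B₂ ≤ (L^kε)·C·m·(1 + L^k((R₀−R₁)⁻¹ + s⁻¹))·E·F`
  have hscale : P.eps⁻¹ * P.spacing k ^ 2 = P.spacing k * (P.L : ℝ) ^ k := by
    rw [Params.spacing]
    field_simp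
  have hΛle : Λ ≤ Λ₀ * ((R₀ - R₁)⁻¹ + (s : ℝ)⁻¹) := by
    rw [hΛdef, mul_add]
    refine add_le_add ?_ ?_
    · rw [div_eq_mul_inv]
      exact mul_le_mul_of_nonneg_right (le_max_left _ _) (inv_pos.mpr hgap').le
    · have e : 3 * Real.pi * (d + 1 : ℕ) / (2 * s) = (3 * Real.pi * (d + 1 : ℕ) / 2) * (s : ℝ)⁻¹ := by
        field_simp
      rw [e]
      exact mul_le_mul_of_nonneg_right (le_max_right _ _) (inv_pos.mpr hsr).le
  have h1 : m * B₁ ≤ P.spacing k * (C * m * 1 * E * F) := by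
    have : B₁ ≤ P.spacing k * (C * E * F) := by
      rw [hB₁def]
      refine mul_le_mul_of_nonneg_left ?_ hsp0.le
      exact mul_le_mul_of_nonneg_right (mul_le_mul hC1 hE1 (Real.exp_pos _).le hC0) hF0
    calc m * B₁ ≤ m * (P.spacing k * (C * E * F)) := mul_le_mul_of_nonneg_left this hm0
      _ = P.spacing k * (C * m * 1 * E * F) := by ring
  have h2 : P.eps⁻¹ * (2 * m * B₂) ≤ P.spacing k * (C * m * ((P.L : ℝ) ^ k * ((R₀ - R₁)⁻¹ + (s : ℝ)⁻¹)) * E * F) := by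
    have e : P.eps⁻¹ * (2 * m * B₂) =
        P.spacing k * ((2 * c₂ * Λ) * m * (P.L : ℝ) ^ k * Real.exp (-(δ₂ * (((P.L : ℝ) ^ k)⁻¹ * D))) * F) := by
      rw [hB₂def]
      have : P.eps⁻¹ * (2 * m * (P.spacing k ^ 2 * (c₂ * Real.exp (-(δ₂ * (((P.L : ℝ) ^ k)⁻¹ * D))) * (Λ * F)))) =
          (P.eps⁻¹ * P.spacing k ^ 2) * (2 * c₂ * Λ * m * Real.exp (-(δ₂ * (((P.L : ℝ) ^ k)⁻¹ * D))) * F) := by ring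
      rw [this, hscale]; ring
    rw [e]
    refine mul_le_mul_of_nonneg_left ?_ hsp0.le
    have hcoef : 2 * c₂ * Λ * m * (P.L : ℝ) ^ k ≤ C * m * ((P.L : ℝ) ^ k * ((R₀ - R₁)⁻¹ + (s : ℝ)⁻¹)) := by
      have h3 : 2 * c₂ * Λ ≤ C * ((R₀ - R₁)⁻¹ + (s : ℝ)⁻¹) := by
        calc 2 * c₂ * Λ ≤ 2 * c₂ * (Λ₀ * ((R₀ - R₁)⁻¹ + (s : ℝ)⁻¹)) := mul_le_mul_of_nonneg_left hΛle (by positivity)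
          _ = (2 * c₂ * Λ₀) * ((R₀ - R₁)⁻¹ + (s : ℝ)⁻¹) := by ring
          _ ≤ C * ((R₀ - R₁)⁻¹ + (s : ℝ)⁻¹) :=
              mul_le_mul_of_nonneg_right (by linarith) (by positivity)
      calc 2 * c₂ * Λ * m * (P.L : ℝ) ^ k = (2 * c₂ * Λ) * (m * (P.L : ℝ) ^ k) := by ring
        _ ≤ (C * ((R₀ - R₁)⁻¹ + (s : ℝ)⁻¹)) * (m * (P.L : ℝ) ^ k) := mul_le_mul_of_nonneg_right h3 (by positivity)
        _ = C * m * ((P.L : ℝ) ^ k * ((R₀ - R₁)⁻¹ + (s : ℝ)⁻¹)) := by ring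
    exact mul_le_mul_of_nonneg_right (mul_le_mul hcoef hE2 (Real.exp_pos _).le (by positivity)) hF0
  refine ((norm_add_le _ _).trans (add_le_add hsum1 hsum2)).trans ?_
  calc m * B₁ + P.eps⁻¹ * (2 * m * B₂)
      ≤ P.spacing k * (C * m * 1 * E * F) + P.spacing k * (C * m * ((P.L : ℝ) ^ k * ((R₀ - R₁)⁻¹ + (s : ℝ)⁻¹)) * E * F) :=
        add_le_add h1 h2
    _ = P.spacing k * (C * m * (1 + (P.L : ℝ) ^ k * ((R₀ - R₁)⁻¹ + (s : ℝ)⁻¹)) * E * F) := by ring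

end Generic

/-! ## §3 The covariant-derivative member of (2.30) for the smooth product cut-off `ζ^Π(R₁, R₀)` -/

section ZetaPiMember

/-- **THE COVARIANT-DERIVATIVE MEMBER OF (2.30) AT `u = 1^h` FOR `G_{k,loc}` BUILT FROM THE TORUS CUBES AND WEIGHTS OF RECORD AND THE SMOOTH
PRODUCT CUT-OFF `ζ″ = ζ^Π(R₁, R₀)`** (print p. 263: *"ζ_k … a smooth function of x₁ − x₂"*, *"Bounds analogous to (2.30) … hold for covariant
derivatives"*): THERE EXIST `δ₀, c₀ > 0` depending on `(d, ℓ, a)` and the universal profile bound `C_σ` only such that, for all data as in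
`deriv230_flat_of_lipschitz` (`0 ≤ R₁ < R₀`), `‖D^ε_{1^h}(G_{k,loc}(1^h)f)(⟨x, x+e_μ⟩)‖ ≤ (L^kε)·c₀·m·(1 + L^k((R₀ − R₁)⁻¹ + s⁻¹))·e^{−δ₀D/L^k}·F`.
[cite: BalabanImbrieJaffe1988, (2.30) p.263] -/
theorem deriv230_flat_zetaPi (d ℓ : ℕ) (hℓ : 1 ≤ ℓ) {a : ℝ} (ha : 0 < a) :
    ∃ δ₀ c₀ : ℝ, 0 < δ₀ ∧ 0 < c₀ ∧ ∀ (P : Params) (hPd : P.d = d + 1), P.L = ℓ + 1 →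
      ∀ k : ℕ, 1 ≤ k → k ≤ P.K → ∀ (c M0 : Fin (d + 1) → ℕ), (∀ i, 1 ≤ M0 i) →
        (∀ i, c i * P.L ^ k + P.L ^ k * M0 i ≤ P.sitesPerDir 0) → (∀ i, P.L ^ k * M0 i < P.sitesPerDir 0) →
      ∀ (s W : ℕ), 1 ≤ s → ∀ (R R₀ R₁ : ℝ), 1 < R → 0 ≤ R₁ → R₁ < R₀ → 2 * (s : ℝ) / 3 + R₀ / 2 + R ≤ W →
        (∀ i, ((P.L ^ k * M0 i : ℕ) : ℝ) + R ≤ P.sitesPerDir 0) →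
      ∀ (h : GaugeTransf P 0 U1) (x : Balaban1983to89.Site P 0) (μ : Fin P.d),
        x ∈ (cubeT hPd (P.L ^ k) c fun i => P.L ^ k * M0 i) →
        (∀ i, R₀ ≤ (boxCoord hPd (P.L ^ k) c x i : ℝ) ∧ (boxCoord hPd (P.L ^ k) c x i : ℝ) + R₀ ≤ (P.L ^ k * M0 i : ℕ) - 1) →
        x.shift μ ∈ (cubeT hPd (P.L ^ k) c fun i => P.L ^ k * M0 i) →
        (∀ i, R₀ ≤ (boxCoord hPd (P.L ^ k) c (x.shift μ) i : ℝ) ∧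
          (boxCoord hPd (P.L ^ k) c (x.shift μ) i : ℝ) + R₀ ≤ (P.L ^ k * M0 i : ℕ) - 1) →
      ∀ (f : Balaban1983to89.Site P 0 → ℂ) (F D : ℝ), (∀ y, ‖f y‖ ≤ F) → 0 ≤ D → (∀ y, f y ≠ 0 → D ≤ B5Ineq137Torus.T P 0 x y) →
        ‖covD P.eps⁻¹ (cfg (gaugeAct h (1 : GaugeField P 0 U1)))
            (gLocT (B1RG242Torus.α P a k * (P.L : ℝ) ^ (k * P.d)) P.eps⁻¹ (gaugeAct h (1 : GaugeField P 0 U1)) k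
              (cubeFam hPd (P.L ^ k) c M0 s W) (lamFam hPd (P.L ^ k) c M0 s) (zetaPi R₁ R₀ 0) *ᵥ f) ⟨x, μ⟩‖ ≤
          P.spacing k * (c₀ * (⌊(((P.L : ℝ) ^ k) - 1 + R₀) / s⌋₊ + 3) ^ (d + 1) *
            (1 + (P.L : ℝ) ^ k * ((R₀ - R₁)⁻¹ + (s : ℝ)⁻¹)) * Real.exp (-(δ₀ * (((P.L : ℝ) ^ k)⁻¹ * D))) * F) := by
  obtain ⟨C, hC0, hC1, -⟩ := exists_abs_deriv_and_deriv_deriv_smoothTransition_le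
  obtain ⟨δ₀, c₀, hδ₀, hc₀, H⟩ := deriv230_flat_of_lipschitz d ℓ hℓ ha hC0
  refine ⟨δ₀, c₀, hδ₀, hc₀, ?_⟩
  intro P hPd hPL k hk1 hkK c M0 hM0 hfit0 hN0 s W hs R R₀ R₁ hR hR₁ hR10 hW hgap h x μ hx hdeep hxe hdeepe f F D hF hD hsupp
  exact H P hPd hPL k hk1 hkK c M0 hM0 hfit0 hN0 s W hs R R₀ R₁ hR hR₁ hR10 hW hgap (zetaPi R₁ R₀ 0) (abs_zetaPi_zero_le_one R₁ R₀)
    (zetaPi_zero_eq_zero_of_le hR10) (abs_zetaPi_zero_shift_sub_le hC1 hR10) h x μ hx hdeep hxe hdeepe f F D hF hD hsupp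

end ZetaPiMember

end

end Literature.MathematicalPhysics.QuantumFieldTheory.BalabanImbrieJaffe1984to88.BIJ88LocDeriv230ZetaPiFlatTorus
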